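import Mathlib.Analysis.Normed.Module.Connected
import Literature.Topology.FourManifolds.SliceGenus
import Literature.Topology.FourManifolds.ClosedBallParallelizable
import Literature.Topology.FourManifolds.SmoothOrientationProofs
import HarnessLib

/-!
# Slice genus zero: smoothly slice knots have `g₄ = 0`, and the reduction of `g₄(K) = 0 ↔ K slice`

Second sibling proof file of `Literature/Topology/FourManifolds/SliceGenus.lean` (fact item
`provefact-Literature.Knot.sliceGenus_eq_zero_iff`; the first sibling, `SliceGenusProofs.lean`,
discharges the push-in fact `Literature.Topology.FourManifolds.Knot.HasSeifertSurfaceOfGenus.hasSliceSurfaceOfGenus`). That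
file defines, for a knot `K : 𝕊¹ → 𝕊³`,
slice surfaces of genus `g` (`Literature.Topology.FourManifolds.Knot.HasSliceSurfaceOfGenus`: a compact connected orientable
smooth surface `S` with one boundary circle, model `𝓡∂ 2`, smoothly embedded in `ℝ⁴` with
boundary `K` and interior in the open unit ball), Seifert surfaces
(`Literature.Topology.FourManifolds.Knot.HasSeifertSurfaceOfGenus`, the same inside `𝕊³`), the slice genus
`g₄(K) = Literature.Knot.sliceGenus K` (an `sInf`), and vendors as named facts (D-0014), among others,

* `Literature.Knot.sliceGenus_eq_zero_iff : ∀ K, K.sliceGenus = 0 ↔ K.IsSmoothlySlice` — the bridge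
  between "`g₄(K) = 0`" (Juhász, *Differential and Low-Dimensional Topology* (2023), Def. 4.25:
  "A knot is called *slice* if `g₄(K) = 0`") and the tree's `Literature.Topology.FourManifolds.Knot.IsSmoothlySlice`
  (`SliceRibbon.lean`: `K` bounds a *neat* smooth slice disc `ℝ² ⊇ 𝔻² → B⁴`, Fox 1962, §7);
* `Literature.Topology.FourManifolds.Knot.exists_hasSeifertSurfaceOfGenus` — Seifert's theorem (every knot bounds a Seifert
  surface) — and `Literature.Topology.FourManifolds.Knot.HasSeifertSurfaceOfGenus.hasSliceSurfaceOfGenus` — pushing it into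
  `B⁴`, discharged in `SliceGenusProofs.lean` — which together make the set
  `{g | K.HasSliceSurfaceOfGenus g}` nonempty.

## Results (all proved, sorry-free)

* `Literature.Topology.FourManifolds.Knot.IsSliceDisc.hasSliceSurfaceOfGenus_zero`,
  `Literature.Topology.FourManifolds.Knot.sliceGenus_eq_zero_of_isSmoothlySlice` — **the direction `←` of
  `sliceGenus_eq_zero_iff`**: a neat slice disc `f : ℝ² → ℝ⁴` restricted to the closed unit
  disc `𝔻²`, with the tree's manifold-with-boundary structure on closed balls
  (`Literature.Topology.FourManifolds.instChartedSpaceClosedBall`, `ClosedBall.lean`; boundary `= 𝕊¹`, interior `=` open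
  disc), is a slice surface of genus `0`: `f ∘ Subtype.val` is smooth
  (`Literature.Topology.FourManifolds.contMDiff_coe_closedBall`) with injective differential
  (`Literature.Topology.FourManifolds.isInvertible_mfderiv_coe_closedBall`), `𝔻²` is orientable
  (`Literature.Topology.FourManifolds.isOrientable_of_simplyConnectedSpace_holds`) and `H₁(𝔻²; ℤ) = 0` (contractibility and
  homotopy invariance of singular homology, Mathlib).
* `Literature.Topology.FourManifolds.Knot.sliceGenus_eq_zero_iff_of_exists`, `Literature.Topology.FourManifolds.Knot.sliceGenus_eq_zero_iff_of_facts` —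
  **reduction of the direction `→`** to the nonemptiness of `{g | K.HasSliceSurfaceOfGenus g}`
  (Seifert's theorem `Literature.Topology.FourManifolds.Knot.exists_hasSeifertSurfaceOfGenus` plus the push-in fact; needed
  because `sliceGenus` is an `sInf`, with junk value `0` on the empty set) and the geometric
  core "a genus-`0` slice surface can be replaced by a neat slice disc parametrised by
  `𝔻² ⊆ ℝ²`" (hypothesis `hD`; the sibling file `SliceGenusDisc.lean`
  derives it, as `Literature.Topology.FourManifolds.Knot.HasSliceSurfaceOfGenus.isSmoothlySlice_of_facts`, from three printed
  theorems vendored there as named facts — the classification of compact surfaces (Hirsch 1976,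
  Ch. 9, Thm. 3.7: a genus-`0` surface with one boundary circle is a disc), Seeley's extension
  theorem (1964) for the closed disc, and Hirsch 1976, Ch. 8, Thm. 3.3 (every diffeomorphism of
  `𝕊¹` extends over `𝔻²`) — together with the tree's neatening theorem
  `Literature.Topology.FourManifolds.Knot.isSmoothlySlice_of_isProperDisc_holds`, `HomotopyBallSliceProofs.lean`).

## References

* R. H. Fox, *A quick trip through knot theory*, in: Topology of 3-manifolds (1962), §7
  [Fox1962].
* A. Juhász, *Differential and Low-Dimensional Topology*, LMS Student Texts 104, CUP (2023),
  Def. 4.25 (p. 114 of the held copy) [Juhasz2023].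
* C. Livingston, *A survey of classical knot concordance*, Handbook of knot theory (2005), §2
  [Livingston2005].
* M. W. Hirsch, *Differential Topology*, GTM 33 (1976), Ch. 9, Thm. 3.7 and Thm. 3.11
  [HirschDT1976].
* R. T. Seeley, *Extension of `C^∞` functions defined in a half space*, Proc. AMS 15 (1964)
  625–626 [Seeley1964].
-/

open scoped Manifold ContDiff Topology
open Function Set Metric CategoryTheory Limits

noncomputable section

namespace Literature.Topology.FourManifolds

/-- Local notation: `𝔼 n` is the model Euclidean space `EuclideanSpace ℝ (Fin n)`. -/
local notation "𝔼 " n:arg => EuclideanSpace ℝ (Fin n)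

/-- Local notation: `𝕊 n` is the unit sphere in `EuclideanSpace ℝ (Fin (n + 1))`. -/
local notation "𝕊 " n:arg => (Metric.sphere (0 : EuclideanSpace ℝ (Fin (n + 1))) 1)

/-- Local notation: `𝔻 n` is the closed unit ball in `EuclideanSpace ℝ (Fin n)`, with the
manifold-with-boundary structure `Literature.Topology.FourManifolds.instChartedSpaceClosedBall` (model `𝓡∂ n`) for `n ≥ 1`. -/
local notation "𝔻 " n:arg => (Metric.closedBall (0 : EuclideanSpace ℝ (Fin n)) 1)

/-! ### The closed ball: boundary sphere and vanishing homology -/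

/-- **`∂𝔻ⁿ⁺¹ ≃ₜ 𝕊ⁿ`**: the boundary of the closed ball (for the model with corners
`𝓡∂ (n + 1)`), as a subtype of `𝔻ⁿ⁺¹`, is homeomorphic to the unit sphere by `x ↦ x` (in
both directions); this is the tree's `Literature.Topology.FourManifolds.boundary_closedBall` (`∂𝔻ⁿ⁺¹ = {‖x‖ = 1}`)
packaged as the existence of a homeomorphism commuting with the inclusions into `ℝⁿ⁺¹`.
Lee, *Introduction to Smooth Manifolds* (2013), Problem 1-11. [folklore] -/
theorem exists_homeomorph_boundary_closedBall (n : ℕ) :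
    ∃ e : ↥((𝓡∂ (n + 1)).boundary (𝔻 (n + 1))) ≃ₜ ↥(𝕊 n),
      ∀ x, ((e x : 𝕊 n) : 𝔼 (n + 1)) = ((x : 𝔻 (n + 1)) : 𝔼 (n + 1)) :=
  ⟨{ toFun := fun x => ⟨((x : 𝔻 (n + 1)) : 𝔼 (n + 1)), mem_sphere_zero_iff_norm.2
        ((Set.ext_iff.1 (boundary_closedBall n) (x : 𝔻 (n + 1))).1 x.2)⟩,
      invFun := fun p => ⟨⟨(p : 𝔼 (n + 1)), sphere_subset_closedBall p.2⟩,
        (Set.ext_iff.1 (boundary_closedBall n) _).2 (norm_eq_of_mem_sphere p)⟩,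
      left_inv := fun x => rfl,
      right_inv := fun p => rfl,
      continuous_toFun := by fun_prop,
      continuous_invFun := by fun_prop }, fun _ => rfl⟩

/-- **`Hₖ(𝔻ⁿ⁺¹; ℤ)` has rank `0` for `k ≠ 0`**: the closed ball is contractible (Mathlib's
`Metric.contractibleSpace_closedBall`), hence homotopy equivalent to a point, whose positive-degree
singular homology vanishes (`Literature.AlgebraicTopology.SingularHomology.singularHomology.isoOfHomotopyEquiv`,
`Literature.AlgebraicTopology.SingularHomology.isZero_singularHomology_of_subsingleton`; Hatcher, *Algebraic Topology* (2002), Cor. 2.11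
and Prop. 2.8). [folklore] -/
theorem finrank_singularHomology_closedBall_eq_zero (n : ℕ) {k : ℕ} (hk : k ≠ 0) :
    Module.finrank ℤ (Literature.AlgebraicTopology.SingularHomology.singularHomology ℤ ℤ (𝔻 (n + 1)) k) = 0 := by
  haveI : ContractibleSpace (𝔻 (n + 1)) := Metric.contractibleSpace_closedBall zero_le_one
  obtain ⟨e⟩ := ContractibleSpace.hequiv_unit (𝔻 (n + 1))
  have hz : IsZero (Literature.AlgebraicTopology.SingularHomology.singularHomology ℤ ℤ (𝔻 (n + 1)) k) :=
    (Literature.AlgebraicTopology.SingularHomology.isZero_singularHomology_of_subsingleton ℤ ℤ (X := Unit) hk).of_iso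
      (Literature.AlgebraicTopology.SingularHomology.singularHomology.isoOfHomotopyEquiv ℤ ℤ e k)
  haveI := ModuleCat.subsingleton_of_isZero hz
  exact Module.finrank_zero_of_subsingleton

namespace Knot

/-! ### Direction `←`: smoothly slice knots have slice genus `0` -/

variable {K : Knot}

/-- **A neat slice disc is a slice surface of genus `0`.** If `f : ℝ² → ℝ⁴` is a slice disc for
`K` (`Literature.Topology.FourManifolds.Knot.IsSliceDisc`), then its restriction `f ∘ Subtype.val` to the closed unit disc
`𝔻²`, a compact connected orientable smooth surface with boundary circle `∂𝔻² = 𝕊¹`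
(`Literature.Topology.FourManifolds.instIsManifoldClosedBall`, `Literature.Topology.FourManifolds.boundary_closedBall`, `Literature.Topology.FourManifolds.interior_closedBall`,
`Literature.Topology.FourManifolds.isOrientable_of_simplyConnectedSpace_holds`) and `H₁(𝔻²; ℤ) = 0`, is a smooth injective
immersion (`Literature.Topology.FourManifolds.contMDiff_coe_closedBall`, `Literature.Topology.FourManifolds.isInvertible_mfderiv_coe_closedBall` and the
chain rule) restricting to `K` on the boundary and mapping the interior into the open ball, i.e.
`K.HasSliceSurfaceOfGenus 0`. Neatness of `f` is not used. Juhász (2023), Def. 4.25;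
Fox (1962), §7. [cite: Juhasz2023, Def. 4.25] -/
theorem IsSliceDisc.hasSliceSurfaceOfGenus_zero {f : 𝔼 2 → 𝔼 4} (hf : K.IsSliceDisc f) :
    K.HasSliceSurfaceOfGenus 0 := by
  obtain ⟨hsmooth, hinj, hder, hint, -, hbd⟩ := hf
  haveI : ConnectedSpace (𝔻 2) := isConnected_iff_connectedSpace.1
    ((convex_closedBall (0 : 𝔼 2) 1).isPathConnected ⟨0, by simp⟩).isConnected
  obtain ⟨e, he⟩ := exists_homeomorph_boundary_closedBall 1
  refine ⟨𝔻 2, inferInstance, inferInstance, inferInstance, inferInstance, inferInstance,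
    inferInstance, inferInstance, f ∘ Subtype.val, e, ?_, ?_⟩
  · refine ⟨?_, ?_, ?_, ?_, ?_, ?_⟩
    · -- orientable: contractible, hence simply connected
      haveI : ContractibleSpace (𝔻 2) := Metric.contractibleSpace_closedBall zero_le_one
      exact isOrientable_of_simplyConnectedSpace_holds
    · exact hsmooth.contMDiff.comp contMDiff_coe_closedBall
    · exact injOn_iff_injective.1 hinj
    · intro x
      have hval : MDifferentiableAt (𝓡∂ 2) 𝓘(ℝ, 𝔼 2)
          (Subtype.val : (𝔻 2) → 𝔼 2) x :=
        (contMDiff_coe_closedBall x).mdifferentiableAt (by simp)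
      have hfd : MDifferentiableAt 𝓘(ℝ, 𝔼 2) 𝓘(ℝ, 𝔼 4) f (x : 𝔼 2) :=
        ((hsmooth.differentiable (by simp)) _).mdifferentiableAt
      rw [mfderiv_comp x hfd hval, mfderiv_eq_fderiv]
      exact (hder x x.2).comp (isInvertible_mfderiv_coe_closedBall x).injective
    · intro x
      rw [comp_apply, ← hbd (e x), he x]
    · rw [Nat.mul_zero]
      exact finrank_singularHomology_closedBall_eq_zero 1 one_ne_zero
  · intro x hx
    rw [interior_closedBall] at hx
    exact hint x hx

/-- A smoothly slice knot bounds a slice surface of genus `0` (its slice disc restricted to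
`𝔻²`). Juhász (2023), Def. 4.25; Fox (1962), §7. [cite: Juhasz2023, Def. 4.25] -/
theorem IsSmoothlySlice.hasSliceSurfaceOfGenus_zero (h : K.IsSmoothlySlice) :
    K.HasSliceSurfaceOfGenus 0 := by
  obtain ⟨f, hf⟩ := h
  exact hf.hasSliceSurfaceOfGenus_zero

/-- **Smoothly slice knots have slice genus `0`** (direction `←` of the named fact
`Literature.Topology.FourManifolds.Knot.sliceGenus_eq_zero_iff`, proved unconditionally). Juhász (2023), Def. 4.25;
Livingston (2005), §2. [cite: Juhasz2023, Def. 4.25] -/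
theorem sliceGenus_eq_zero_of_isSmoothlySlice (h : K.IsSmoothlySlice) : K.sliceGenus = 0 :=
  Nat.eq_zero_of_le_zero (sliceGenus_le_of_hasSliceSurfaceOfGenus h.hasSliceSurfaceOfGenus_zero)

/-! ### Reduction of `sliceGenus_eq_zero_iff` to the remaining named facts -/

/-- **`g₄(K) = 0 ↔ K` is smoothly slice, from two inputs**: (i) every knot bounds a slice surface
of some genus (`hN`; without it the `sInf` defining `sliceGenus` could be the junk value `0`),
and (ii) the geometric core `hD`: a knot bounding a genus-`0` slice surface is smoothly slice in
the sense of `Literature.Topology.FourManifolds.Knot.IsSmoothlySlice` (a genus-`0` spanning surface is a disc by the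
classification of surfaces, Hirsch (1976), Ch. 9, Thm. 3.7, reparametrised by `𝔻² ⊆ ℝ²` and
extended to `ℝ²` by Seeley (1964), then neatened — the tree's
`Literature.Topology.FourManifolds.Knot.isSmoothlySlice_of_isProperDisc_holds`). The direction `←` is
`sliceGenus_eq_zero_of_isSmoothlySlice`. Juhász (2023), Def. 4.25; Fox (1962), §7.
[cite: Juhasz2023, Def. 4.25] -/
theorem sliceGenus_eq_zero_iff_of_exists (hN : ∀ K : Knot, ∃ g, K.HasSliceSurfaceOfGenus g)
    (hD : ∀ {K : Knot} (_h : K.HasSliceSurfaceOfGenus 0), K.IsSmoothlySlice) :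
    sliceGenus_eq_zero_iff := by
  intro K
  refine ⟨fun h0 => hD ?_, sliceGenus_eq_zero_of_isSmoothlySlice⟩
  have h := Nat.sInf_mem (hN K)
  change K.HasSliceSurfaceOfGenus K.sliceGenus at h
  rwa [h0] at h

/-- **Reduction of the named fact `Literature.Topology.FourManifolds.Knot.sliceGenus_eq_zero_iff`** to Seifert's theorem
`Literature.Topology.FourManifolds.Knot.exists_hasSeifertSurfaceOfGenus` (`hS`: every knot bounds a Seifert surface; Seifert
1934), the push-in fact `Literature.Topology.FourManifolds.Knot.HasSeifertSurfaceOfGenus.hasSliceSurfaceOfGenus` (`hP`,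
discharged in `SliceGenusProofs.lean` as `…_holds`) and the genus-`0` core `hD` (derived in
`SliceGenusDisc.lean`, `Literature.Topology.FourManifolds.Knot.HasSliceSurfaceOfGenus.isSmoothlySlice_of_facts`, from the
classification of surfaces, Seeley's extension theorem and Hirsch's extension of circle
diffeomorphisms; its conclusion has exactly the binder shape of `hD`); the direction `←` is
proved above. Juhász (2023), Def. 4.25; Livingston (2005), §2. [cite: Juhasz2023, Def. 4.25] -/
theorem sliceGenus_eq_zero_iff_of_facts (hS : exists_hasSeifertSurfaceOfGenus)
    (hP : HasSeifertSurfaceOfGenus.hasSliceSurfaceOfGenus)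
    (hD : ∀ {K : Knot} (_h : K.HasSliceSurfaceOfGenus 0), K.IsSmoothlySlice) :
    sliceGenus_eq_zero_iff :=
  sliceGenus_eq_zero_iff_of_exists (exists_hasSliceSurfaceOfGenus hS hP) hD

end Knot

end Literature.Topology.FourManifolds
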